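import Summits.CriticalPhenomena.PercolationContinuityZ3.Theorems.Transplant.GrigorchukLamplighterBlockCharKernel
import Summits.CriticalPhenomena.PercolationContinuityZ3.Theorems.Transplant.AutEndStateOrbitQuasi
import HarnessLib

/-!
# Bartholdi–Erschler's `Cay(ℤ ≀_X 𝔊; a, b, c, d, s)` CARRIES THE END STATE'S QUASI-STEP ORBIT DATUM (`AutChart.OrbitQDatum`: two orbits, the block character,
# scale `N = 1`, tight quasi-steps of length `≤ 2`, kernel displacement `≤ 11`) — it satisfies the HYPOTHESIS of the open end-state node
# `BenjaminiSchramm1996_conj4_endState`, which therefore PREDICTS `θ(p_c) = 0` on it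

builds on p205010 (kernel theorem, internal audit signed; external expert review pending) — nothing in this file uses p205010.  The `@[conjecture]`
`BenjaminiSchramm1996_conj4_endState` («AutEndStateDefs», OPEN) is neither edited nor asserted: it appears only as a HYPOTHESIS (§3).  Lane `prim-bschramm`,
seat `prim-bschramm-p3` gen 36 (design owner; offer O14 / F4, lead GO 2026-08-28 #7877).  Helper file (`--supports stmt-CriticalPhenomena-4575 --as helper`).
ONE definition (`Grigorchuk.cayQDatum`, the datum term); everything else is a theorem over p582067 («GrigorchukLamplighterDefs»/«…CriticalContinuity»:
`stabOneW`, `blockChar`, `transversal_cover/inj`, `lip_letters`), «GrigorchukLamplighterCayleyClasses» (`Cay`, `L6`) and «GrigorchukLamplighterBlockCharKernel» (`ker_gen`).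

WHAT.  For the action of `A = (⊕_X ℤ) ⋊ St(1) ≤ Γ₂` on `Cay = Cay(ℤ ≀_X 𝔊; a,b,c,d,s)` by left multiplication and the block character `ψ = (Σ_{0T} f, Σ_{1T} f)`:
* §1 coset labels `b • r`, `r ∈ {1, a}`, are unique (transversal + free action), so every vertex has ONE label `ψ b`; edge values have sup-norm `≤ 1`
  (p582067 `lip_letters`); **TIGHT QUASI-STEPS OF LENGTH `≤ 2`** at both representatives (`qstep_std`): at `1`, `± e₁` along the edge `1 — s^{±1}` and `± e₀`
  along the walk `1 — a — a s^{±1}`; at `a`, `± e₀` along `a — a s^{±1}` and `± e₁` along `a — 1 — s^{±1}`; every vertex on these walks carries the label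
  `0`, `± e₀` or `± e₁` (exact footprint);
* §2 **`cayQDatum : AutChart.OrbitQDatum Cay ↥stabOneW`** (`N = 1`, `M = 2`, `m = 11`; `ker_gen` from «…BlockCharKernel» `ker_blockChar_le_closure`);
* §3 **`cay_theta_eq_zero_of_endState`**: `BenjaminiSchramm1996_conj4_endState → θ_v(p_c) = 0` on `Cay` («AutEndStateOrbitQuasi» `orbitQuasi_of_conj4_endState`).
CENSUS (class words only): the graph SATISFIES the end-state node's datum hypothesis — finitely many orbits, a rank-two character killing every stabiliser,
exact-footprint quasi-steps of length `≤ 2`, bounded kernel displacement.  NOTHING is asserted about the quasi-step carrier's connectivity input (hC — offer O3,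
HOLD), about `BenjaminiSchramm1996_conj4_endState` itself, or about `θ(p_c)` on `Cay` unconditionally (NOT PROVED, tree or print).  No growth statement enters.
[cite: BartholdiErschler2012, §2 (standard generating set; A-edges and G-edges of the Cayley graph), §3.1 (St(1), ρ = 1^∞)]
[cite: BenjaminiSchramm1996, Conj. 4; §2 (almost transitive graphs)] [cite: KozmaNitzan2024, §4 p. 16 (Lemma 8)]
-/

noncomputable section

namespace Summit.CriticalPhenomena.PercolationContinuityZ3.Theorems.Transplant

namespace Grigorchuk

open SimpleGraph SemidirectProduct Literature.Barriers.CriticalPhenomena Literature.Probability.LatticeModels Literature.Probability.Percolation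
open scoped Classical

/-! ### §1 Unique coset labels, edge values, tight quasi-steps of length `≤ 2` -/

/-- Coset labels are unique: `b • r″ = b₀ • r₀` with `r″, r₀ ∈ {1, a}` forces `b = b₀` (transversal + free action). [folklore] -/
theorem eq_of_smul_eq {b b₀ : ↥stabOneW} {r'' r₀ : ↥wreathZ} (hr'' : r'' ∈ ({1, aW} : Finset ↥wreathZ)) (hr₀ : r₀ ∈ ({1, aW} : Finset ↥wreathZ))
    (e : b • r'' = b₀ • r₀) : b = b₀ := by
  have e' : (b : ↥wreathZ) * r'' = (b₀ : ↥wreathZ) * r₀ := e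
  have hr : r'' = r₀ := transversal_inj r'' hr'' r₀ hr₀ (b₀⁻¹ * b) (by
    rw [show (((b₀⁻¹ * b : ↥stabOneW)) : ↥wreathZ) = ((b₀ : ↥wreathZ))⁻¹ * (b : ↥wreathZ) from rfl, mul_assoc, e', inv_mul_cancel_left])
  rw [hr] at e'
  exact Subtype.ext (mul_right_cancel e')

/-- The sup-norm bound at a vertex with a known label. [folklore] -/
theorem abs_le_of_label {x r₀ : ↥wreathZ} {b₀ : ↥stabOneW} (hr₀ : r₀ ∈ ({1, aW} : Finset ↥wreathZ)) (e₀ : b₀ • r₀ = x)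
    (hb₀ : ∀ j : Fin 2, |Multiplicative.toAdd (blockChar b₀) j| ≤ ((1 : ℕ) : ℤ)) :
    ∀ (b : ↥stabOneW) (r'' : ↥wreathZ), r'' ∈ ({1, aW} : Finset ↥wreathZ) → b • r'' = x → ∀ j : Fin 2, |Multiplicative.toAdd (blockChar b) j| ≤ ((1 : ℕ) : ℤ) :=
  fun b r'' hr'' e j => by rw [eq_of_smul_eq hr'' hr₀ (e.trans e₀.symm)]; exact hb₀ j

/-- `|± eᵢ|_∞ ≤ 1`. [folklore] -/
theorem abs_single_le {m : ℤ} (hm : m = 1 ∨ m = -1) (i j : Fin 2) : |(Pi.single i m : Fin 2 → ℤ) j| ≤ ((1 : ℕ) : ℤ) := by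
  rw [Nat.cast_one]
  by_cases h : j = i
  · rw [h, Pi.single_eq_same]; rcases hm with rfl | rfl <;> simp
  · rw [Pi.single_eq_of_ne h, abs_zero]; exact zero_le_one

/-- The label `0` has sup-norm `≤ 1`. [folklore] -/
theorem abs_toAdd_blockChar_one_le (j : Fin 2) : |Multiplicative.toAdd (blockChar (1 : ↥stabOneW)) j| ≤ ((1 : ℕ) : ℤ) := by
  rw [map_one, toAdd_one, Pi.zero_apply, abs_zero, Nat.cast_one]; exact zero_le_one

/-- **TIGHT QUASI-STEPS OF LENGTH `≤ 2` at both representatives** (scale `1`): at `1`, `± e₁` along the edge `1 — s^{±1}` and `± e₀` along `1 — a — a s^{±1}`; at `a`,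
`± e₀` along `a — a s^{±1}` and `± e₁` along `a — 1 — s^{±1}`; every vertex on these walks has the unique label `0`, `± e₀` or `± e₁`.
[cite: BartholdiErschler2012, §2 (A-edges toggle the lamp at ρg⁻¹)] [cite: KozmaNitzan2024, §4 p. 16 (Lemma 8)] -/
theorem qstep_std : ∀ r ∈ ({1, aW} : Finset ↥wreathZ), ∀ (i : Fin 2) (σ : ℤˣ), ∃ (a : ↥stabOneW) (r' : ↥wreathZ) (p : Cay.Walk r (a • r')),
    r' ∈ ({1, aW} : Finset ↥wreathZ) ∧ p.length ≤ 2 ∧ Multiplicative.toAdd (blockChar a) = Pi.single i (((1 : ℕ) : ℤ) * σ) ∧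
      ∀ x ∈ p.support, ∀ (b : ↥stabOneW) (r'' : ↥wreathZ), r'' ∈ ({1, aW} : Finset ↥wreathZ) → b • r'' = x →
        ∀ j : Fin 2, |Multiplicative.toAdd (blockChar b) j| ≤ ((1 : ℕ) : ℤ) := by
  intro r hr i σ
  have hm : (σ : ℤ) = 1 ∨ (σ : ℤ) = -1 := by rcases Int.units_eq_one_or σ with rfl | rfl <;> simp
  rw [Nat.cast_one, one_mul]
  have h1m : (1 : ↥wreathZ) ∈ ({1, aW} : Finset ↥wreathZ) := by simp
  have ham : aW ∈ ({1, aW} : Finset ↥wreathZ) := by simp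
  have haa : aW * aW = 1 := tree_letters_sq.1
  have hadj_a1 : Cay.Adj aW 1 := by have h := cay_adj_mul aW .a; rwa [show L6.a.toW = aW from rfl, haa] at h
  have hadj_1a : Cay.Adj 1 aW := by have h := cay_adj_mul 1 .a; rwa [one_mul] at h
  obtain ⟨ℓ, hℓ⟩ := exists_lampCode hm
  -- the two labelled lamp elements: `s^σ = (ρ ↦ σ)` with label `σ e₁` and `a s^σ a = (aρ ↦ σ)` with label `σ e₀`
  set sS : ↥stabOneW := ⟨ℓ.toW, lamp_mem_stabOneW (by rw [hℓ, lamp_right])⟩ with hsS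
  set tS : ↥stabOneW := ⟨aW * ℓ.toW * aW, lamp_mem_stabOneW (by rw [coe_conj_aW_of_eq_lamp hℓ, lamp_right])⟩ with htS
  have hψs : Multiplicative.toAdd (blockChar sS) = Pi.single 1 (σ : ℤ) := by
    have h := toAdd_blockChar_of_left_eq sS (by rw [hsS]; change (((ℓ.toW : ↥wreathZ)) : LampGroup ℤ).left = _; rw [hℓ, lamp_left])
    rwa [show rho 0 = true from rfl, if_pos rfl] at h
  have hψt : Multiplicative.toAdd (blockChar tS) = Pi.single 0 (σ : ℤ) := by
    have h := toAdd_blockChar_of_left_eq tS (by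
      rw [htS]; change (((aW * ℓ.toW * aW : ↥wreathZ)) : LampGroup ℤ).left = _; rw [coe_conj_aW_of_eq_lamp hℓ, lamp_left])
    rwa [show (if genA rho 0 = true then (1 : Fin 2) else 0) = 0 by simp [genA_rho_zero]] at h
  have hbs : ∀ j : Fin 2, |Multiplicative.toAdd (blockChar sS) j| ≤ ((1 : ℕ) : ℤ) := fun j => by rw [hψs]; exact abs_single_le hm 1 j
  have hbt : ∀ j : Fin 2, |Multiplicative.toAdd (blockChar tS) j| ≤ ((1 : ℕ) : ℤ) := fun j => by rw [hψt]; exact abs_single_le hm 0 j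
  -- the labels of the four vertices `1, a, s^σ, a s^σ`
  have L1 := abs_le_of_label (b₀ := 1) h1m (one_smul _ _) abs_toAdd_blockChar_one_le
  have La := abs_le_of_label (b₀ := 1) ham (one_smul _ _) abs_toAdd_blockChar_one_le
  have Ls := abs_le_of_label (b₀ := sS) (x := ℓ.toW) h1m (mul_one _) hbs
  have Lt := abs_le_of_label (b₀ := tS) (x := aW * ℓ.toW) ham (show aW * ℓ.toW * aW * aW = aW * ℓ.toW by rw [mul_assoc, haa, mul_one]) hbt
  simp only [Finset.mem_insert, Finset.mem_singleton] at hr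
  rcases hr with rfl | rfl <;> fin_cases i
  · -- at `1`, axis 0: the walk `1 — a — a s^σ = tS • a`
    refine ⟨tS, aW, (Walk.cons hadj_1a (Walk.cons (cay_adj_mul aW ℓ) Walk.nil)).copy rfl ?_, ham, ?_, hψt, ?_⟩
    · show aW * ℓ.toW = aW * ℓ.toW * aW * aW; rw [mul_assoc (aW * ℓ.toW), haa, mul_one]
    · rw [Walk.length_copy, Walk.length_cons, Walk.length_cons, Walk.length_nil]
    · intro x hx
      rw [Walk.support_copy, Walk.support_cons, Walk.support_cons, Walk.support_nil, List.mem_cons, List.mem_cons, List.mem_singleton] at hx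
      rcases hx with rfl | rfl | rfl
      exacts [L1, La, Lt]
  · -- at `1`, axis 1: the edge `1 — s^σ = sS • 1`
    refine ⟨sS, 1, (Walk.cons (cay_adj_mul 1 ℓ) Walk.nil).copy rfl ?_, h1m, ?_, hψs, ?_⟩
    · show (1 : ↥wreathZ) * ℓ.toW = ℓ.toW * 1; rw [one_mul, mul_one]
    · rw [Walk.length_copy, Walk.length_cons, Walk.length_nil]; norm_num
    · intro x hx
      rw [Walk.support_copy, Walk.support_cons, Walk.support_nil, List.mem_cons, List.mem_singleton] at hx
      rcases hx with rfl | rfl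
      · exact L1
      · rw [one_mul]; exact Ls
  · -- at `a`, axis 0: the edge `a — a s^σ = tS • a`
    refine ⟨tS, aW, (Walk.cons (cay_adj_mul aW ℓ) Walk.nil).copy rfl ?_, ham, ?_, hψt, ?_⟩
    · show aW * ℓ.toW = aW * ℓ.toW * aW * aW; rw [mul_assoc (aW * ℓ.toW), haa, mul_one]
    · rw [Walk.length_copy, Walk.length_cons, Walk.length_nil]; norm_num
    · intro x hx
      rw [Walk.support_copy, Walk.support_cons, Walk.support_nil, List.mem_cons, List.mem_singleton] at hx
      rcases hx with rfl | rfl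
      exacts [La, Lt]
  · -- at `a`, axis 1: the walk `a — 1 — s^σ = sS • 1`
    refine ⟨sS, 1, (Walk.cons hadj_a1 (Walk.cons (cay_adj_mul 1 ℓ) Walk.nil)).copy rfl ?_, h1m, ?_, hψs, ?_⟩
    · show (1 : ↥wreathZ) * ℓ.toW = ℓ.toW * 1; rw [one_mul, mul_one]
    · rw [Walk.length_copy, Walk.length_cons, Walk.length_cons, Walk.length_nil]
    · intro x hx
      rw [Walk.support_copy, Walk.support_cons, Walk.support_cons, Walk.support_nil, List.mem_cons, List.mem_cons, List.mem_singleton] at hx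
      rcases hx with rfl | rfl | rfl
      · exact La
      · exact L1
      · rw [one_mul]; exact Ls

/-- Letters of `{a, b, c, d, s}^{±}` are letters of the lamp-complete set `{a, b, c, d, s, asa}^{±}`. [folklore] -/
theorem toW_mem_lampCompleteGens_or (y : L6) : y.toW ∈ lampCompleteGens ∨ (y.toW)⁻¹ ∈ lampCompleteGens := by
  cases y
  · exact Or.inl (by simp [L6.toW, lampCompleteGens])
  · exact Or.inl (by simp [L6.toW, lampCompleteGens])
  · exact Or.inl (by simp [L6.toW, lampCompleteGens])
  · exact Or.inl (by simp [L6.toW, lampCompleteGens])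
  · exact Or.inl (by simp [L6.toW, lampCompleteGens])
  · exact Or.inr (by simp [L6.toW, lampCompleteGens])

/-! ### §2 The datum -/

/-- **THE QUASI-STEP ORBIT DATUM ON `Cay(ℤ ≀_X 𝔊; a, b, c, d, s)`**: the action of `(⊕_X ℤ) ⋊ St(1)` by left multiplication (two orbits, transversal `{1, a}`), the
block character (kills the trivial stabilisers), scale `N = 1`, edge values of sup-norm `≤ 1` (p582067 `lip_letters`), tight quasi-steps of length `M = 2`
(`qstep_std`), kernel displacement bound `m = 11` (`ker_blockChar_le_closure`).  The HYPOTHESIS SIDE of the end-state node for this graph; nothing about the node itself.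
[cite: BartholdiErschler2012, §2, §3.1] [cite: BenjaminiSchramm1996, §2 (almost transitive graphs)] [cite: KozmaNitzan2024, §4 p. 16 (Lemma 8)] -/
def cayQDatum : AutChart.OrbitQDatum Cay ↥stabOneW where
  act := CayleyCosets.isActionByAut_leftCoset stdGens stabOneW
  conn := CayleyScaled.connected_mulCayley_of_closure stdGens (by rw [stdGens]; simpa only [Finset.coe_insert, Finset.coe_singleton] using closure_standardGens)
  reps := {1, aW}
  cover w := transversal_cover w
  trans := transversal_inj
  ψ a := Multiplicative.toAdd (blockChar a)
  ψ_mul a b := by rw [map_mul, toAdd_mul]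
  ψ_stab v h hh := by
    have e : (h : ↥wreathZ) * v = v := MulAction.mem_stabilizer_iff.1 hh
    have h1 : h = 1 := Subtype.ext (mul_right_cancel (e.trans (one_mul v).symm))
    rw [h1, map_one, toAdd_one]
  N := 1
  one_le_N := le_rfl
  lipN r hr r' hr' a ha i := by
    obtain ⟨y, hy⟩ := cay_adj_iff.1 ha
    exact lip_letters r hr y.toW (toW_mem_lampCompleteGens_or y) a r' hr' hy.symm i
  M := 2
  qstep := qstep_std
  m := 11
  ker_gen r hr k hk := by
    refine Subgroup.closure_mono ?_ (ker_blockChar_le_closure k hk)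
    intro g hg
    refine ⟨hg.1, ?_⟩
    simp only [Finset.mem_insert, Finset.mem_singleton] at hr
    rcases hr with rfl | rfl
    · show (g : ↥wreathZ) * 1 ∈ graphBall Cay 1 11
      rw [mul_one]; exact graphBall_mono _ _ (by norm_num) hg.2
    · exact mul_aW_mem_graphBall hg.2

/-! ### §3 The end-state node predicts `θ(p_c) = 0` on Bartholdi–Erschler's graph -/

/-- **END-STATE CONTINUITY ⟹ `θ_v(p_c) = 0` ON `Cay(ℤ ≀_X 𝔊; a, b, c, d, s)`** — the graph carries the quasi-step orbit datum `cayQDatum`, i.e. satisfies the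
hypothesis of the OPEN end-state node («AutEndStateOrbitQuasi» `orbitQuasi_of_conj4_endState`).  CONDITIONAL on `BenjaminiSchramm1996_conj4_endState` (a hypothesis
here, not asserted); `θ(p_c) = 0` on this graph is NOT proved in the tree or in print. [cite: BenjaminiSchramm1996, Conj. 4; §2 (almost transitive graphs)]
[cite: BartholdiErschler2012, Thm. 5.3] -/
theorem cay_theta_eq_zero_of_endState (hE : BenjaminiSchramm1996_conj4_endState) [Cay.LocallyFinite] (v : ↥wreathZ) :
    theta Cay v (criticalProbIOf Cay v) = 0 :=
  AutChart.orbitQuasi_of_conj4_endState hE Cay cayQDatum v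

end Grigorchuk

end Summit.CriticalPhenomena.PercolationContinuityZ3.Theorems.Transplant

end
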